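import Summits.BirchSwinnertonDyer.BirchSwinnertonDyer.Theorems.KimAtThreeShallowEqDeepMultOfDefinedKatoRows
import Summits.BirchSwinnertonDyer.BirchSwinnertonDyer.Theorems.KimAtThreeShallowEqDeepNonAdditiveOfFineKato
import HarnessLib

/-!
# Route `KimAtThreeKolyvagin` (W2): crux 19599's `stub_nonAdditive` VERBATIM, crux 19599 BY NAME and crux 19077
# BY NAME from the leaves + the DEFINED-KATO package (C1ₑₓ¹ᵘ) [non-additive rows] + (C1_τ) [good ANOMALOUS rows
# only] + (C1₂) [additive-defect rows] — the OWNER's assembly, second form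

Cell `bsd-addord`, seat `bsd-addord-w2-c4` (gen 10; OWNER of crux 19599 `ShallowEqDeepOffKatoStratum`, item 19077
`ShallowEqDeepAtTorsionFree`).  `--supports` 19077.  HONEST FRAMING: END THEOREMS WITH DISPLAYED HYPOTHESES (no
definition, no named fact, no instance, no `sorry`); the conclusions are the registered stub text / route decls BY
NAME but CONDITIONAL on the route's cite-only leaves and THREE displayed construction-shaped packages; nothing
closed, nothing booked; 19560 / 19599 / 19077 stay OPEN; BSD is not proved by any of this.

## What (compared with the first form `KimAtThreeShallowEqDeepNonAdditiveOfFineKato`, p506396)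
There the non-additive rows were served by two rider-level packages, (C1_τ) on ALL good rows and (C1′₂) on the
multiplicative rows.  Here the non-additive NON-ANOMALOUS rows (every multiplicative row — `a₃ = ±1` — and the good
rows with `3 ∤ 4 − a₃`) are served by **(C1ₑₓ¹ᵘ)** = seat w2-c3's DEFINED-KATO package (C1ₑₓ) of the deep cruxes
19075 / 19076 / 19562 / 19679 (`KimAtThreeDeepUpperOfDefinedKatoUniform`, the planner's Variant-EX text) read with
the EXACT crude exponent `b = 1` and R-κ (gen 10 `KimAtThreeShallowEqDeepMultOfDefinedKato.fineKato₁₂_of_definedKatoUnit`),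
and (C1_τ) is displayed ONLY on the good ANOMALOUS rows (`3 ∤ N`, `3 ∣ 4 − a₃`), where the Euler-factor lattice is
finer than `3⁻¹𝒪` and the crude reading loses a digit (gens 8–9).
* §1 `stub19599_nonAdditive_of_definedKatoUnit_of_fineKatoτ : [S24](1) → [S24](2) → GZK → PT → (C1ₑₓ¹ᵘ)[non-additive]
  → (C1_τ)[good anomalous] → ⟨stub_nonAdditive VERBATIM⟩` (dispatch on the non-anomaly certificate
  `3 ∤ 3 + 𝟙_{3∤N} − a₃`; an anomalous row is good since `a₃ = ±1` at a multiplicative `3`).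
* §2 `shallowEqDeepOffKatoStratum_of_leaves_of_definedKatoUnit : … → (C1₂) → ShallowEqDeepOffKatoStratum` (19599 BY NAME).
* §3 `shallowEqDeepAtTorsionFree_of_leaves_of_definedKatoUnit : SakamotoKolyvaginThree → RankEqAnalyticRankLeOne →
  PoitouTateSelmerDuality → CarayolLevelEqConductor → KatoKuriharaPortThreeShared → (C1ₑₓ¹ᵘ) → (C1_τ)[anom] → (C1₂)
  → ShallowEqDeepAtTorsionFree` (19077 BY NAME).
READING (08-28 residual of record, W2): 19599 / 19077 ⟸ leaves (∧ 19560 for 19077) ∧ (C1ₑₓ¹ᵘ)[non-additive t = 0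
rows; implies (C1ₑₓ) there] ∧ (C1_τ)[good anomalous t = 0 rows] ∧ (C1₂)[additive-defect rows].
References: [BlochKato1990] §3; [Kato2004Asterisque] (8.1.3), §9.4, Thm. 9.7, Thm. 6.6 (1), Ex. 13.3;
[Kim2022StructureSelmer] §3.2.3, Lemma 3.3/3.4/3.10, Thm. 3.13, Thm. 1.9 (6); [Kim2025RefinedTNC] Thm 1.1/1.2;
[MazurRubin2004] Thm. 4.4.1, 5.2.12, App. A; [Sakamoto2024] Thm. 4.4; [Silverman1994] IV.10.2(a); [SilvermanAEC2009]
§C.16, VII.6; memo HOME/w2c4/W2C4-MULT-TWOEXP-g10.md.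
-/

set_option autoImplicit false
-- the Theorems namespace of a single-conjunct summit repeats the summit name by design (D-0017)
set_option linter.dupNamespace false

noncomputable section

open scoped NumberField TensorProduct ContRepresentation Classical
open CategoryTheory Field Function Finset IsDedekindDomain NumberField WeierstrassCurve
open Rat.HeightOneSpectrum
open Literature.NumberTheory.GaloisRepresentations Literature.NumberTheory.GaloisCohomology
open Literature.NumberTheory.GaloisRepresentations.DiscreteGaloisModule
open Literature.NumberTheory.EllipticCurves Literature.NumberTheory.EllipticCurves.ModularForms
open Literature.NumberTheory.EllipticCurves.Rank1Residual
open Literature.NumberTheory.EllipticCurves.Kato2004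
open Literature.NumberTheory.EllipticCurves.Kato2004.EulerSystemValues
open Summit.BirchSwinnertonDyer.Rank1Residual.GaloisImage
open Summit.BirchSwinnertonDyer.Rank1Residual.Additive.LocalLog
open Summit.BirchSwinnertonDyer.BirchSwinnertonDyer.Theses.KimAtThreeKolyvagin
open Summit.BirchSwinnertonDyer.BirchSwinnertonDyer.Theorems
open Summit.BirchSwinnertonDyer.BirchSwinnertonDyer.Theorems.KimAtThreeKolyvaginDefs
open Summit.BirchSwinnertonDyer.BirchSwinnertonDyer.Theorems.KimAtThreeShallowEqDeepSplitGlueNoStub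
open Summit.BirchSwinnertonDyer.BirchSwinnertonDyer.Theorems.KimAtThreeShallowEqDeepNonAdditiveOfFineKato

namespace Summit.BirchSwinnertonDyer.BirchSwinnertonDyer.Theorems.KimAtThreeShallowEqDeepOffStratumOfDefinedKato

/-! ### The displayed packages (local notation) -/

/-- Local notation: the TWO-EXPONENT rider clause (ii₂) at depth `j`, torsion slot `t`, defect exponent `e`,
place `v`, for the pair `(Λ, Λf)` (seat acc6's RIDER₂, VERBATIM). -/
local notation3 (prettyPrint := false) "RIDER₂⟦" W' ", " j ", " t' ", " e' ", " v' ", " Λ' ", " Λf "⟧" =>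
  ∀ (r : Finset (HeightOneSpectrum (𝓞 ℚ)))
    (Ψ : H1 (tateRep W' 3) (cycSubgroup 3 0 r) →+
      continuousCohomology 1
        (subgroupRep (WeierstrassCurve.torsionGaloisModule W' (((3 : ℕ) : ℤ) ^ j * ((3 : ℕ) : ℤ))).toTopRep
          (cycSubgroup 3 0 r))),
    (∀ (φ : contOneCocycles (subgroupRep (tateRep W' 3).toTopRep (cycSubgroup 3 0 r)))
        (ψ : contOneCocycles
          (subgroupRep (WeierstrassCurve.torsionGaloisModule W' (((3 : ℕ) : ℤ) ^ j * ((3 : ℕ) : ℤ))).toTopRep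
            (cycSubgroup 3 0 r))),
        (∀ g, ((ψ.1 g : geomTorsion W' (((3 : ℕ) : ℤ) ^ j * ((3 : ℕ) : ℤ))) : geomPoints W') =
          TateModule.proj 3 (j + 1) (φ.1 g)) →
        Ψ (oneCocycleClass _ φ) = oneCocycleClass _ ψ) →
    ∀ (y : H1 (tateRep W' 3) (cycSubgroup 3 0 r))
      (κ₀ : galoisCohomology (WeierstrassCurve.torsionGaloisModule W' (((3 : ℕ) : ℤ) ^ j * ((3 : ℕ) : ℤ))) 1)
      (s : ℤ_[3]),
      resSubgroup (WeierstrassCurve.torsionGaloisModule W' (((3 : ℕ) : ℤ) ^ j * ((3 : ℕ) : ℤ))).toTopRep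
          (cycSubgroup 3 0 r) 1 κ₀ = Ψ y →
      galoisCohomology.localization (WeierstrassCurve.torsionGaloisModule W' (((3 : ℕ) : ℤ) ^ j * ((3 : ℕ) : ℤ)))
          (Sum.inr v') 1 κ₀ ∈ propagatedSelmerStructure W' 3 j (Sum.inr v') →
      (∃ l ∈ cycIntLattice 3 (cycLevel 3 0 r),
          (((3 : ℕ) : ℤ_[3]) ^ t') • Λ' 0 r y - ((s : ℚ_[3]) ⊗ₜ[ℚ] (1 : CyclotomicField (cycLevel 3 0 r) ℚ)) =
            (((3 : ℕ) : ℤ_[3]) ^ (j + 1)) • (l : ℚ_[3] ⊗[ℚ] CyclotomicField (cycLevel 3 0 r) ℚ)) →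
      ((3 ^ e' : ℕ) : ZMod (3 ^ (j + 1))) *
        Λf (galoisCohomology.localization
          (WeierstrassCurve.torsionGaloisModule W' (((3 : ℕ) : ℤ) ^ j * ((3 : ℕ) : ℤ))) (Sum.inr v') 1 κ₀) =
        PadicInt.toZModPow (j + 1) s

/-- Local notation: the TWISTED rider clause (ii_τ) at depth `j`, place `v`, integer model `t₃` of `a₃`, for
the pair `(Λ, Λf)` — premise on the Euler-factor lattice `(1 ⊗ (3 − t₃δ_w + δ_{w²}))·L_int` (`w·[3] = 1`),
scalar `s·(3 − t₃ + 1)` (this seat's gen 9, VERBATIM). -/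
local notation3 (prettyPrint := false) "RIDERτ⟦" W' ", " j ", " v' ", " t3 ", " Λ' ", " Λf "⟧" =>
  ∀ (r : Finset (HeightOneSpectrum (𝓞 ℚ))) (w : (ZMod (cycLevel 3 0 r))ˣ),
    (w : ZMod (cycLevel 3 0 r)) * ((3 : ℕ) : ZMod (cycLevel 3 0 r)) = 1 →
    ∀ (Ψ : H1 (tateRep W' 3) (cycSubgroup 3 0 r) →+
        continuousCohomology 1
          (subgroupRep (WeierstrassCurve.torsionGaloisModule W' (((3 : ℕ) : ℤ) ^ j * ((3 : ℕ) : ℤ))).toTopRep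
            (cycSubgroup 3 0 r))),
      (∀ (φ : contOneCocycles (subgroupRep (tateRep W' 3).toTopRep (cycSubgroup 3 0 r)))
          (ψ : contOneCocycles
            (subgroupRep (WeierstrassCurve.torsionGaloisModule W' (((3 : ℕ) : ℤ) ^ j * ((3 : ℕ) : ℤ))).toTopRep
              (cycSubgroup 3 0 r))),
          (∀ g, ((ψ.1 g : geomTorsion W' (((3 : ℕ) : ℤ) ^ j * ((3 : ℕ) : ℤ))) : geomPoints W') =
            TateModule.proj 3 (j + 1) (φ.1 g)) →
          Ψ (oneCocycleClass _ φ) = oneCocycleClass _ ψ) →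
      ∀ (y : H1 (tateRep W' 3) (cycSubgroup 3 0 r))
        (κ₀ : galoisCohomology (WeierstrassCurve.torsionGaloisModule W' (((3 : ℕ) : ℤ) ^ j * ((3 : ℕ) : ℤ))) 1)
        (s : ℤ_[3]),
        resSubgroup (WeierstrassCurve.torsionGaloisModule W' (((3 : ℕ) : ℤ) ^ j * ((3 : ℕ) : ℤ))).toTopRep
            (cycSubgroup 3 0 r) 1 κ₀ = Ψ y →
        galoisCohomology.localization (WeierstrassCurve.torsionGaloisModule W' (((3 : ℕ) : ℤ) ^ j * ((3 : ℕ) : ℤ)))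
            (Sum.inr v') 1 κ₀ ∈ propagatedSelmerStructure W' 3 j (Sum.inr v') →
        (∃ l ∈ cycIntLattice 3 (cycLevel 3 0 r),
            ((3 : ℕ) : ℤ_[3]) • Λ' 0 r y -
                (((s * (((3 : ℕ) : ℤ_[3]) - (t3 : ℤ_[3]) + 1) : ℤ_[3]) : ℚ_[3]) ⊗ₜ[ℚ]
                  (1 : CyclotomicField (cycLevel 3 0 r) ℚ)) =
              ((3 : ℤ_[3]) ^ (j + 1)) • ∑ g : (ZMod (cycLevel 3 0 r))ˣ,
                ((((((3 : ℕ) : MonoidAlgebra ℤ_[3] (ZMod (cycLevel 3 0 r))ˣ)) -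
                    MonoidAlgebra.single w (t3 : ℤ_[3]) +
                    MonoidAlgebra.single (w ^ 2) (1 : ℤ_[3])).coeff g : ℤ_[3]) : ℚ_[3]) •
                  Algebra.TensorProduct.map (AlgHom.id ℚ ℚ_[3])
                    (sigma (cycLevel 3 0 r) g : CyclotomicField (cycLevel 3 0 r) ℚ →ₐ[ℚ]
                      CyclotomicField (cycLevel 3 0 r) ℚ) l) →
        Λf (galoisCohomology.localization (WeierstrassCurve.torsionGaloisModule W' (((3 : ℕ) : ℤ) ^ j * ((3 : ℕ) : ℤ)))
            (Sum.inr v') 1 κ₀) = PadicInt.toZModPow (j + 1) s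

/-- Local notation: the (Λ)-clauses of DICT3 for the finite-level functional `Λf j` at `v` (onto `ℤ/3^{j+1}` on
`𝓕_can(v)`, kernel the Kummer part). -/
local notation3 (prettyPrint := false) "LAMBDA⟦" W' ", " v' ", " Λf "⟧" =>
  ∀ j : ℕ,
    (∀ c : ZMod (3 ^ (j + 1)), ∃ x ∈ propagatedSelmerStructure W' 3 j (Sum.inr v'), Λf j x = c) ∧
    (∀ x ∈ propagatedSelmerStructure W' 3 j (Sum.inr v'),
      Λf j x = 0 ↔ x ∈ WeierstrassCurve.kummerSelmerStructure W' (((3 : ℕ) : ℤ) ^ j * ((3 : ℕ) : ℤ)) (Sum.inr v'))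

/-- Local notation: Kato's `ZetaBody` FAMILY for `(ι, κK, Λ)` and the cusp form `f'` at level `N'`. -/
local notation3 (prettyPrint := false) "ZBODY⟦" W' ", " N' ", " f' ", " ι' ", " κ' ", " Λ' "⟧" =>
  ∀ (c d a : ℤ) (A : ℕ), 0 < A → Int.gcd c (6 * 3 * A) = 1 → Int.gcd d (6 * 3 * N') = 1 →
    ∃ (z : ∀ (k' : ℕ) (r : (cyclotomicLevelsRat 3 (badPlaces c d A N')).Ideals),
          H1 (tateRep W' 3) ((cyclotomicLevelsRat 3 (badPlaces c d A N')).level k' r.1))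
      (x : ∀ (k' : ℕ) (r : (cyclotomicLevelsRat 3 (badPlaces c d A N')).Ideals),
          CyclotomicField (cycLevel 3 k' r.1) ℚ),
      ZetaBody W' 3 f' ι' κ' Λ' c d a A z x

/-- Local notation: **(C1_τ) at the row `(W, v, D)`** — gen 9's fine Kato package on the Euler-factor lattice
(`t₃` an integer model of `a₃(f)`), instance binders universally quantified. -/
local notation3 (prettyPrint := false) "FINEKATOτ⟦" W' ", " v' ", " N' ", " D' ", " t3 "⟧" =>
  ∀ [ContinuousSMul ℤ_[3] (WeierstrassCurve.tateModule W' 3)] [Module.Free ℤ_[3] (WeierstrassCurve.tateModule W' 3)]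
    [Module.Finite ℤ_[3] (WeierstrassCurve.tateModule W' 3)],
    ∃ (ι : (n : ℕ) → (CyclotomicField n ℚ →+* ℂ)) (κK : ℝ)
      (Λ : ∀ (k' : ℕ) (r : Finset (HeightOneSpectrum (𝓞 ℚ))),
        H1 (tateRep W' 3) (cycSubgroup 3 k' r) →ₗ[ℤ_[3]]
          ℚ_[3] ⊗[ℚ] CyclotomicField (cycLevel 3 k' r) ℚ)
      (Λfin : ∀ j : ℕ, galoisCohomology
        ((WeierstrassCurve.torsionGaloisModule W' (((3 : ℕ) : ℤ) ^ j * ((3 : ℕ) : ℤ))).toLocal (Sum.inr v')) 1 →+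
          ZMod (3 ^ (j + 1))),
      κK ≠ 0 ∧ (∃ u : ℚ, (u : ℝ) = κK ∧ padicValRat 3 u = 0) ∧
      (LAMBDA⟦W', v', Λfin⟧) ∧
      (∀ j : ℕ, RIDERτ⟦W', j, v', t3, Λ, Λfin j⟧) ∧
      ZBODY⟦W', N', (D' : ModularParametrizationData W' N').f, ι, κK, Λ⟧

/-- Local notation: the crude compatibility X1-int at depth `j` WITH EXPONENT `b := 1` between Kato's value datum
`Λ_{0,r}` and the scalar dual exponential `φ` at `v` (seat w2-c3's X1-int_b text with `b = 1`). -/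
local notation3 (prettyPrint := false) "COMPAT₁⟦" W' ", " j ", " v' ", " Λ' ", " φ0 "⟧" =>
  ∀ (r : Finset (HeightOneSpectrum (𝓞 ℚ)))
    (Ψ : H1 (tateRep W' 3) (cycSubgroup 3 0 r) →+
      continuousCohomology 1 (subgroupRep
        (WeierstrassCurve.torsionGaloisModule W' (((3 : ℕ) : ℤ) ^ j * ((3 : ℕ) : ℤ))).toTopRep (cycSubgroup 3 0 r))),
    (∀ (φ₁ : contOneCocycles (subgroupRep (tateRep W' 3).toTopRep (cycSubgroup 3 0 r)))
        (ψ : contOneCocycles (subgroupRep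
          (WeierstrassCurve.torsionGaloisModule W' (((3 : ℕ) : ℤ) ^ j * ((3 : ℕ) : ℤ))).toTopRep (cycSubgroup 3 0 r))),
        (∀ g, ((ψ.1 g : geomTorsion W' (((3 : ℕ) : ℤ) ^ j * ((3 : ℕ) : ℤ))) : geomPoints W') =
          TateModule.proj 3 (j + 1) (φ₁.1 g)) →
        Ψ (oneCocycleClass _ φ₁) = oneCocycleClass _ ψ) →
    ∀ (y : H1 (tateRep W' 3) (cycSubgroup 3 0 r))
      (κ₀ : galoisCohomology (WeierstrassCurve.torsionGaloisModule W' (((3 : ℕ) : ℤ) ^ j * ((3 : ℕ) : ℤ))) 1)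
      (h : (tateLocalRep W' 3 (Sum.inr v')).cohomology 1),
      resSubgroup (WeierstrassCurve.torsionGaloisModule W' (((3 : ℕ) : ℤ) ^ j * ((3 : ℕ) : ℤ))).toTopRep
          (cycSubgroup 3 0 r) 1 κ₀ = Ψ y →
      galoisCohomology.localization (WeierstrassCurve.torsionGaloisModule W' (((3 : ℕ) : ℤ) ^ j * ((3 : ℕ) : ℤ)))
          (Sum.inr v') 1 κ₀ = tateLocalMap W' 3 j (Sum.inr v') h →
      ∃ l ∈ cycIntLattice 3 (cycLevel 3 0 r),
        (((3 : ℕ) : ℤ_[3]) ^ (1 : ℕ)) • ((φ0 h ⊗ₜ[ℚ] (1 : CyclotomicField (cycLevel 3 0 r) ℚ)) - Λ' 0 r y) =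
          (((3 : ℕ) : ℤ_[3]) ^ (j + 1)) • (l : ℚ_[3] ⊗[ℚ] CyclotomicField (cycLevel 3 0 r) ℚ)

/-- Local notation: **(C1ₑₓ¹ᵘ) at the row `(W, v, P)`** — seat w2-c3's DEFINED-KATO package (C1ₑₓ) with the crude
exponent FIXED to `b = 1` and R-κ added: `(ι, κK, Λ, φ)` with `κK ≠ 0` a rational `3`-adic unit, `hker`, `hdual`,
COMPAT₁ at every depth, and Kato's `ZetaBody` family for `P.f`. -/
local notation3 (prettyPrint := false) "DEFKATO₁ᵘ⟦" W' ", " v' ", " N' ", " P' "⟧" =>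
  ∃ (ι : (n : ℕ) → (CyclotomicField n ℚ →+* ℂ)) (κK : ℝ)
    (Λ : ∀ (k' : ℕ) (r : Finset (HeightOneSpectrum (𝓞 ℚ))),
      H1 (tateRep W' 3) (cycSubgroup 3 k' r) →ₗ[ℤ_[3]] ℚ_[3] ⊗[ℚ] CyclotomicField (cycLevel 3 k' r) ℚ)
    (φ : (tateLocalRep W' 3 (Sum.inr v')).cohomology 1 →+ ℚ_[3]),
    κK ≠ 0 ∧ (∃ u : ℚ, (u : ℝ) = κK ∧ padicValRat 3 u = 0) ∧
    (∀ y, φ y = 0 ↔ ∀ j : ℕ, tateLocalMap W' 3 j (Sum.inr v') y ∈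
      WeierstrassCurve.kummerSelmerStructure W' (((3 : ℕ) : ℤ) ^ j * ((3 : ℕ) : ℤ)) (Sum.inr v')) ∧
    (∀ a : ℚ_[3], (∃ y, φ y = a) ↔
      ∀ Q : ((W' : WeierstrassCurve ℚ).baseChange ℚ_[3]).toAffine.Point,
        ‖a * padicLog ((W' : WeierstrassCurve ℚ).baseChange ℚ_[3]) Q‖ ≤ 1) ∧
    (∀ j : ℕ, COMPAT₁⟦W', j, v', Λ, φ⟧) ∧
    ∀ (c d a : ℤ) (A : ℕ), 0 < A → Int.gcd c (6 * 3 * A) = 1 → Int.gcd d (6 * 3 * N') = 1 →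
      ∃ (z : ∀ (k' : ℕ) (r : (cyclotomicLevelsRat 3 (badPlaces c d A N')).Ideals),
            H1 (tateRep W' 3) ((cyclotomicLevelsRat 3 (badPlaces c d A N')).level k' r.1))
        (x : ∀ (k' : ℕ) (r : (cyclotomicLevelsRat 3 (badPlaces c d A N')).Ideals),
            CyclotomicField (cycLevel 3 k' r.1) ℚ),
        ZetaBody W' 3 (P' : ModularParametrizationData W' N').f ι κK Λ c d a A z x

/-- Local notation: **(C1₂) ON THE ADDITIVE-DEFECT ROWS** — seat acc3's FINEKATO₂
(`KimAtThreeOffStratumAdditiveDefectOfFineKato`), VERBATIM. -/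
local notation3 (prettyPrint := false) "PKG₂_DEFECT" =>
  ∀ (W : WeierstrassCurve ℚ) [W.IsElliptic] [W.IsGloballyMinimal]
    [ContinuousSMul ℤ_[3] (W.tateModule 3)] [Module.Free ℤ_[3] (W.tateModule 3)]
    [Module.Finite ℤ_[3] (W.tateModule 3)],
    (∀ m : ℕ, W.HasSurjectiveModNGaloisRep (3 ^ m : ℕ)) →
    (haveI : Fact (Nat.Prime 3) := ⟨Nat.prime_three⟩; Addv W 3) →
    Nat.card {Q : (W.baseChange ℚ_[3]).toAffine.Point // (3 : ℕ) • Q = 0} = 1 →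
    ∀ (v₃ : HeightOneSpectrum (𝓞 ℚ)), ((3 : ℕ) : 𝓞 ℚ) ∈ v₃.asIdeal →
    ∀ {N : ℕ} [NeZero N] (P : ModularParametrizationData W N), N = W.conductorNorm ℤ →
      (∀ z ∈ P.L.lattice, ∃ w ∈ periodLattice P.f, z = P.c * w) →
      (3 ∣ (W.baseChange ℚ_[3]).localTamagawaNumber ℤ_[3] ∨ (3 : ℤ) ∣ P.maninConstant) →
      ∃ (ι : (n : ℕ) → (CyclotomicField n ℚ →+* ℂ)) (κK : ℝ)
        (Λ : ∀ (k' : ℕ) (r : Finset (HeightOneSpectrum (𝓞 ℚ))),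
          H1 (tateRep W 3) (cycSubgroup 3 k' r) →ₗ[ℤ_[3]]
            ℚ_[3] ⊗[ℚ] CyclotomicField (cycLevel 3 k' r) ℚ)
        (Λfin : ∀ j : ℕ, galoisCohomology
          ((W.torsionGaloisModule (((3 : ℕ) : ℤ) ^ j * ((3 : ℕ) : ℤ))).toLocal (Sum.inr v₃)) 1 →+
            ZMod (3 ^ (j + 1))) (e : ℕ),
        κK ≠ 0 ∧ (∃ u : ℚ, (u : ℝ) = κK ∧ padicValRat 3 u = 0) ∧
        (∀ j : ℕ,
          (∀ c : ZMod (3 ^ (j + 1)), ∃ x ∈ propagatedSelmerStructure W 3 j (Sum.inr v₃), Λfin j x = c) ∧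
          (∀ x ∈ propagatedSelmerStructure W 3 j (Sum.inr v₃),
            Λfin j x = 0 ↔ x ∈ W.kummerSelmerStructure (((3 : ℕ) : ℤ) ^ j * ((3 : ℕ) : ℤ)) (Sum.inr v₃))) ∧
        (∀ j : ℕ, RIDER₂⟦W, j, 0, e, v₃, Λ, Λfin j⟧) ∧
        ∀ (c d a : ℤ) (A : ℕ), 0 < A → Int.gcd c (6 * 3 * A) = 1 → Int.gcd d (6 * 3 * N) = 1 →
          ∃ (z : ∀ (k' : ℕ) (r : (cyclotomicLevelsRat 3 (badPlaces c d A N)).Ideals),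
                H1 (tateRep W 3) ((cyclotomicLevelsRat 3 (badPlaces c d A N)).level k' r.1))
            (x : ∀ (k' : ℕ) (r : (cyclotomicLevelsRat 3 (badPlaces c d A N)).Ideals),
                CyclotomicField (cycLevel 3 k' r.1) ℚ),
            ZetaBody W 3 P.f ι κK Λ c d a A z x

/-- Local notation: the `stub_nonAdditive` signature of crux 19599 (BC3 birth skeleton
`Cruxes/ShallowEqDeepOffKatoStratum/Lines/birth.lean`), VERBATIM. -/
local notation3 (prettyPrint := false) "STUB19599NA" =>
  ∀ (W₀ : WeierstrassCurve ℚ) [W₀.IsElliptic] [W₀.IsGloballyMinimal],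
    (∀ n : ℕ, W₀.HasSurjectiveModNGaloisRep (3 ^ n : ℕ)) →
    Nat.card {Q : (W₀.baseChange ℚ_[3]).toAffine.Point // (3 : ℕ) • Q = 0} = 1 → Finite W₀.sha →
    ∀ {N : ℕ} [NeZero N], N = W₀.conductorNorm ℤ →
    ∀ (D₀ : Literature.NumberTheory.EllipticCurves.ModularForms.ModularParametrizationData W₀ N),
      (∀ z ∈ D₀.L.lattice, ∃ w ∈ Literature.NumberTheory.EllipticCurves.ModularForms.periodLattice D₀.f, z = D₀.c * w) →
      (∀ (W₂ : WeierstrassCurve ℚ) [W₂.IsElliptic]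
        (D₂ : Literature.NumberTheory.EllipticCurves.ModularForms.ModularParametrizationData W₂ N),
        D₂.f = D₀.f → D₀.modularDegree ≤ D₂.modularDegree) →
      (∀ r : ℚ, Literature.NumberTheory.EllipticCurves.ratPlusSymbol D₀.f r ≠ 0 →
        0 ≤ padicValRat 3 (Literature.NumberTheory.EllipticCurves.ratPlusSymbol D₀.f r)) →
      Literature.NumberTheory.EllipticCurves.kuriharaVanishingOrder W₀ 3 D₀.f = 0 →
      ¬ (haveI : Fact (Nat.Prime 3) := ⟨Nat.prime_three⟩;
          Literature.NumberTheory.EllipticCurves.Rank1Residual.Addv W₀ 3) →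
      Literature.NumberTheory.EllipticCurves.kuriharaPartialDeepInfty W₀ 3 D₀.f ≤
        Literature.NumberTheory.EllipticCurves.kuriharaPartialInfty W₀ 3 D₀.f

/-- Local notation: **(C1ₑₓ¹ᵘ) ON THE NON-ADDITIVE ROWS** — the `∀`-package over the non-additive `t = 0` tower rows
with the datum at the conductor (binders of `stub_nonAdditive`): seat w2-c3's defined-Kato package with `b = 1`
and R-κ, instance binders universally quantified. -/
local notation3 (prettyPrint := false) "PKG_EX1U" =>
  ∀ (W₀ : WeierstrassCurve ℚ) [W₀.IsElliptic] [W₀.IsGloballyMinimal],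
    (∀ n : ℕ, W₀.HasSurjectiveModNGaloisRep (3 ^ n : ℕ)) →
    Nat.card {Q : (W₀.baseChange ℚ_[3]).toAffine.Point // (3 : ℕ) • Q = 0} = 1 →
    ∀ {N : ℕ} [NeZero N], N = W₀.conductorNorm ℤ →
    ∀ (D₀ : ModularParametrizationData W₀ N),
      (∀ z ∈ D₀.L.lattice, ∃ w ∈ periodLattice D₀.f, z = D₀.c * w) →
      (∀ (W₂ : WeierstrassCurve ℚ) [W₂.IsElliptic] (D₂ : ModularParametrizationData W₂ N),
        D₂.f = D₀.f → D₀.modularDegree ≤ D₂.modularDegree) →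
      ¬ (haveI : Fact (Nat.Prime 3) := ⟨Nat.prime_three⟩; Addv W₀ 3) →
    ∀ (v₃ : HeightOneSpectrum (𝓞 ℚ)), ((3 : ℕ) : 𝓞 ℚ) ∈ v₃.asIdeal →
    ∀ [ContinuousSMul ℤ_[3] (WeierstrassCurve.tateModule W₀ 3)] [Module.Free ℤ_[3] (WeierstrassCurve.tateModule W₀ 3)]
      [Module.Finite ℤ_[3] (WeierstrassCurve.tateModule W₀ 3)],
      DEFKATO₁ᵘ⟦W₀, v₃, N, D₀⟧

/-- Local notation: **(C1_τ) ON THE GOOD ANOMALOUS ROWS** — gen 9's package over the good `t = 0` tower rows with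
`3 ∣ 3 + 1 − a₃` (binders of `stub_nonAdditive` + `3 ∤ N` + an integer model `t₃` of `a₃` + anomaly). -/
local notation3 (prettyPrint := false) "PKGτ_ANOM" =>
  ∀ (W₀ : WeierstrassCurve ℚ) [W₀.IsElliptic] [W₀.IsGloballyMinimal],
    (∀ n : ℕ, W₀.HasSurjectiveModNGaloisRep (3 ^ n : ℕ)) →
    Nat.card {Q : (W₀.baseChange ℚ_[3]).toAffine.Point // (3 : ℕ) • Q = 0} = 1 →
    ∀ {N : ℕ} [NeZero N], N = W₀.conductorNorm ℤ →
    ∀ (D₀ : ModularParametrizationData W₀ N),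
      (∀ z ∈ D₀.L.lattice, ∃ w ∈ periodLattice D₀.f, z = D₀.c * w) →
      (∀ (W₂ : WeierstrassCurve ℚ) [W₂.IsElliptic] (D₂ : ModularParametrizationData W₂ N),
        D₂.f = D₀.f → D₀.modularDegree ≤ D₂.modularDegree) →
      ¬ 3 ∣ N →
    ∀ (v₃ : HeightOneSpectrum (𝓞 ℚ)), ((3 : ℕ) : 𝓞 ℚ) ∈ v₃.asIdeal →
    ∀ (t₃ : ℤ), cuspCoeff D₀.f 3 = t₃ → (3 : ℤ) ∣ 3 + 1 - t₃ →
      FINEKATOτ⟦W₀, v₃, N, D₀, t₃⟧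

/-! ### §1 `stub_nonAdditive` of crux 19599 from PUB + (C1ₑₓ¹ᵘ)[non-additive] + (C1_τ)[good anomalous] -/

set_option backward.isDefEq.respectTransparency false in
/-- **`stub_nonAdditive` of crux 19599 (BC3 birth skeleton, VERBATIM) from the published leaves, the defined-Kato
package (C1ₑₓ¹ᵘ) on the non-additive rows and (C1_τ) on the good anomalous rows ALONE.**  Dispatch on the
non-anomaly certificate `3 ∤ 3 + 𝟙_{3∤N} − a₃(W₀)`: if it holds, gen 10's
`shallowEqDeep_row_of_definedKatoUnit_of_nonanomalous`; if it fails the row is GOOD (`a₃ = ±1` at a multiplicative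
`3` by `IsNewformOf.cuspCoeff_eq_one_and_sq_of_split` / `…_eq_neg_one_and_dvd_of_nonsplit`, and then
`3 ∤ 3 − a₃`), so `3 ∤ N` and gen 9's `shallowEqDeep_row_of_fineKatoτ_of_good` applies.  Nothing booked.
[cite: Kim2025RefinedTNC, Thm 1.2] [cite: Kim2022StructureSelmer, Thm. 1.9 (6), §3.2.3, Lemma 3.3/3.4, Thm. 3.13]
[cite: Sakamoto2024, Thm. 4.4 (p. 926)] [cite: MazurRubin2004, Thm. 5.2.12] [cite: BlochKato1990, §3 (Prop. 3.8, Ex. 3.11)]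
[cite: Silverman1994, IV.10.2(a)] [cite: SilvermanAEC2009, §C.16] -/
theorem stub19599_nonAdditive_of_definedKatoUnit_of_fineKatoτ
    (hS24 : Sakamoto2024.kolyvaginSystems_freeRankOne_zmod_three_pow)
    (hS24₂ : Sakamoto2024.kolyvaginSystems_idealOfBasis_eq_fittingIdeal_zmod_three_pow)
    (hGZK : rank_eq_analyticRank_of_analyticRank_le_one) (hPT : poitouTate_selmerStructure_duality ℚ)
    (hEX : PKG_EX1U) (hC1τ : PKGτ_ANOM) : STUB19599NA := by
  intro W₀ _ _ htow ht _ N _ hN D₀ hopt hdeg hint hord hA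
  obtain ⟨v₃, η, hv₃, hη⟩ := exists_place_three_and_generators
  have hf := D₀.isNewformOf
  by_cases h3a : (3 : ℤ) ∣ 3 + (if 3 ∣ N then 0 else 1) - W₀.LFunction 3
  · -- anomalous ⇒ good reduction at `3`
    have hgood : W₀.HasGoodReductionAtPrime 3 := by
      by_contra hgood
      have hmult : W₀.HasMultiplicativeReductionAtPrime 3 := by
        by_contra hm
        exact hA ⟨hgood, hm⟩
      have h3N : 3 ∣ N := by
        by_contra h3N
        rw [hN] at h3N
        exact hgood (hasGoodReductionAtPrime_three_of_not_dvd_conductorNorm W₀ h3N)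
      rw [if_pos h3N] at h3a
      by_cases hsplit : W₀.HasSplitMultiplicativeReductionAtPrime 3
      · have h1 : W₀.LFunction 3 = 1 := by
          have h := (hf.cuspCoeff_eq_one_and_sq_of_split hsplit).1
          rw [hf.2 3] at h
          exact_mod_cast h
        rw [h1] at h3a
        omega
      · have h1 : W₀.LFunction 3 = -1 := by
          have h := (hf.cuspCoeff_eq_neg_one_and_dvd_of_nonsplit hmult hsplit).1
          rw [hf.2 3] at h
          exact_mod_cast h
        rw [h1] at h3a
        omega
    have hN3 : ¬ 3 ∣ N := by
      rw [hN]
      exact not_dvd_conductorNorm_of_hasGoodReductionAtPrime W₀ hgood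
    rw [if_neg hN3] at h3a
    exact KimAtThreeShallowEqDeepAnomalousRows.shallowEqDeep_row_of_fineKatoτ_of_good W₀ hS24 hS24₂ hGZK hPT
      htow ht D₀ hN hint hord v₃ hv₃ η hη (hf.2 3) hN3
      (hC1τ W₀ htow ht hN D₀ hopt hdeg hN3 v₃ hv₃ (W₀.LFunction 3) (hf.2 3) h3a)
  · -- non-anomalous: the defined-Kato package
    exact KimAtThreeShallowEqDeepMultOfDefinedKatoRows.shallowEqDeep_row_of_definedKatoUnit_of_nonanomalous W₀
      hS24 hS24₂ hGZK hPT htow ht D₀ hN hint hord v₃ hv₃ η hη (hf.2 3) h3a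
      (hEX W₀ htow ht hN D₀ hopt hdeg hA v₃ hv₃)

/-! ### §2 Crux 19599 BY NAME -/

/-- **Crux 19599 `ShallowEqDeepOffKatoStratum` BY NAME ⟸ [S24] (1)(2) ∧ GZK ∧ Poitou–Tate ∧ (C1ₑₓ¹ᵘ)[non-additive] ∧
(C1_τ)[good anomalous] ∧ (C1₂)[additive defect]** — the BC3 birth composition on §1 and seat acc3's
`stub19599_additiveDefect_of_fineKato`.  CONDITIONAL; nothing booked; 19599 stays OPEN.
[cite: Kim2025RefinedTNC, Thm 1.1, Thm 1.2] [cite: Kim2022StructureSelmer, Thm. 1.9 (6), Thm. 3.13]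
[cite: Sakamoto2024, Thm. 4.4 (p. 926)] [cite: MazurRubin2004, Thm. 4.4.1 and Thm. 5.2.12] -/
theorem shallowEqDeepOffKatoStratum_of_leaves_of_definedKatoUnit
    (hS24 : Sakamoto2024.kolyvaginSystems_freeRankOne_zmod_three_pow)
    (hS24₂ : Sakamoto2024.kolyvaginSystems_idealOfBasis_eq_fittingIdeal_zmod_three_pow)
    (hGZK : rank_eq_analyticRank_of_analyticRank_le_one) (hPT : poitouTate_selmerStructure_duality ℚ)
    (hEX : PKG_EX1U) (hC1τ : PKGτ_ANOM) (hC1₂ : PKG₂_DEFECT) :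
    ShallowEqDeepOffKatoStratum := by
  intro W₀ _ _ htow ht hfin N _ hN D₀ hopt hdeg hint hord hoff
  by_cases hA : (haveI : Fact (Nat.Prime 3) := ⟨Nat.prime_three⟩; Addv W₀ 3)
  · refine KimAtThreeOffStratumAdditiveDefectOfFineKato.stub19599_additiveDefect_of_fineKato hS24 hS24₂ hGZK hPT
      hC1₂ W₀ htow ht hfin hN D₀ hopt hdeg hint hord hA ?_
    by_contra hcon
    push Not at hcon
    exact hoff ⟨hA, hcon.1, hcon.2⟩
  · exact stub19599_nonAdditive_of_definedKatoUnit_of_fineKatoτ hS24 hS24₂ hGZK hPT hEX hC1τ W₀ htow ht hfin hN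
      D₀ hopt hdeg hint hord hA

/-! ### §3 Crux 19077 BY NAME -/

/-- **Crux 19077 `ShallowEqDeepAtTorsionFree` BY NAME ⟸ the route's four published leaves ∧ crux 19560
`KatoKuriharaPortThreeShared` ∧ (C1ₑₓ¹ᵘ)[non-additive] ∧ (C1_τ)[good anomalous] ∧ (C1₂)[additive defect]** — gen 4's
stub-free glue `shallowEqDeepAtTorsionFree_of_parts_noStub` on §2.  CONDITIONAL; nothing booked; 19077 stays OPEN.
[cite: Kim2025RefinedTNC, Thm 1.2] [cite: Kim2022StructureSelmer, Thm. 1.9 (6), Thm. 3.13]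
[cite: Sakamoto2024, Thm. 4.4 (p. 926)] [cite: MazurRubin2004, Thm. 4.4.1 and Thm. 5.2.12] [cite: Carayol1986] -/
theorem shallowEqDeepAtTorsionFree_of_leaves_of_definedKatoUnit
    (hSak : SakamotoKolyvaginThree) (hGZK : RankEqAnalyticRankLeOne) (hPT : PoitouTateSelmerDuality)
    (hlev : CarayolLevelEqConductor) (hPort : KatoKuriharaPortThreeShared)
    (hEX : PKG_EX1U) (hC1τ : PKGτ_ANOM) (hC1₂ : PKG₂_DEFECT) :
    ShallowEqDeepAtTorsionFree :=
  shallowEqDeepAtTorsionFree_of_parts_noStub hSak hGZK hPT hlev hPort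
    (shallowEqDeepOffKatoStratum_of_leaves_of_definedKatoUnit hSak.1 hSak.2 hGZK hPT hEX hC1τ hC1₂)

end Summit.BirchSwinnertonDyer.BirchSwinnertonDyer.Theorems.KimAtThreeShallowEqDeepOffStratumOfDefinedKato

end
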